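import Summits.Ventures.PercRepro.C026DirectAccess

/-!
# Open balls around a vertex (p5, gen 15)

`G.ball ω a n` is the set of vertices reached from `a` by a walk of at most `n` open edges of `ω` (iterated
open neighbourhoods) — the ball `{v : dist_S(a, v) ≤ n}` of mine-3's Theorem Z (`proofs/MINE3-FLIPS.md` §7)
without a distance function; `G.AtDist ω a X r` says `dist_S(a, X) = r + 1` (the ball of radius `r` misses
`X`, the ball of radius `r + 1` meets it).

* `ball_zero`, `ball_succ`, `self_mem_ball`, `ball_subset_succ`, `ball_mono`, `mem_ball_succ_of_openAdj`,
  `mem_edgesAt_of_openAdj_left`, `notMem_edgesAt_of_notMem_of_notMem`;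
* `conn_of_mem_ball` / `exists_mem_ball_of_conn` — balls exhaust the open cluster of `a`;
* **`ball_eq_of_agree`** — the ball of radius `n` is determined by the states of the edges at the balls of
  radius `< n`;
* **`connAvoid_of_mem_ball`** — a vertex of a ball disjoint from `X` is reached from `a` by an open walk
  avoiding `X`;
* `AtDist`, **`AtDist.unique`** (the distance is unique), `AtDist.not_mem_of_mem_ball`.
-/

namespace PercRepro

namespace MultiGraph

section Ball

variable {V E : Type*} (G : MultiGraph V E)

/-- The open ball of radius `n` around `a`: `ball 0 = {a}`, `ball (n + 1) = ball n ∪ N(ball n)`. -/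
def ball (ω : Config E) (a : V) : ℕ → Set V
  | 0 => {a}
  | n + 1 => ball ω a n ∪ {v | ∃ u ∈ ball ω a n, G.OpenAdj ω u v}

/-- The ball of radius `0`. -/
theorem ball_zero (ω : Config E) (a : V) : G.ball ω a 0 = {a} := rfl

/-- The ball of radius `n + 1`. -/
theorem ball_succ (ω : Config E) (a : V) (n : ℕ) :
    G.ball ω a (n + 1) = G.ball ω a n ∪ {v | ∃ u ∈ G.ball ω a n, G.OpenAdj ω u v} := rfl

variable {G}

/-- The centre lies in every ball. -/
theorem self_mem_ball (ω : Config E) (a : V) (n : ℕ) : a ∈ G.ball ω a n := by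
  induction n with
  | zero => exact Set.mem_singleton a
  | succ n ih => exact Or.inl ih

/-- Balls grow with the radius. -/
theorem ball_subset_succ (ω : Config E) (a : V) (n : ℕ) : G.ball ω a n ⊆ G.ball ω a (n + 1) :=
  Set.subset_union_left

/-- Balls are monotone in the radius. -/
theorem ball_mono (ω : Config E) (a : V) {m n : ℕ} (h : m ≤ n) : G.ball ω a m ⊆ G.ball ω a n := by
  induction h with
  | refl => exact subset_rfl
  | step _ ih => exact ih.trans (ball_subset_succ ω a _)

/-- An open edge from the ball of radius `n` lands in the ball of radius `n + 1`. -/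
theorem mem_ball_succ_of_openAdj {ω : Config E} {a u v : V} {n : ℕ} (hu : u ∈ G.ball ω a n)
    (h : G.OpenAdj ω u v) : v ∈ G.ball ω a (n + 1) :=
  Or.inr ⟨u, hu, h⟩

/-- A vertex of a ball around `a` is connected to `a`. -/
theorem conn_of_mem_ball {ω : Config E} {a : V} {n : ℕ} {v : V} (h : v ∈ G.ball ω a n) :
    G.Conn ω a v := by
  induction n generalizing v with
  | zero =>
    rw [ball_zero, Set.mem_singleton_iff] at h
    rw [h]
    exact Conn.refl G ω a
  | succ n ih =>
    rcases h with h | ⟨u, hu, huv⟩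
    · exact ih h
    · exact (ih hu).tail huv

/-- A vertex connected to `a` lies in some ball around `a`. -/
theorem exists_mem_ball_of_conn {ω : Config E} {a v : V} (h : G.Conn ω a v) :
    ∃ n, v ∈ G.ball ω a n := by
  unfold Conn at h
  induction h with
  | refl => exact ⟨0, self_mem_ball ω a 0⟩
  | tail _ hbc ih =>
    obtain ⟨n, hn⟩ := ih
    exact ⟨n + 1, mem_ball_succ_of_openAdj hn hbc⟩

/-- An open edge at a vertex of `X` is at `X`. -/
theorem mem_edgesAt_of_openAdj_left {X : Set V} {u v : V} {e : E}
    (hu : u ∈ X) (hend : (G.fst e = u ∧ G.snd e = v) ∨ (G.fst e = v ∧ G.snd e = u)) :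
    e ∈ G.edgesAt X := by
  rcases hend with ⟨h1, _⟩ | ⟨_, h2⟩
  · exact Or.inl (h1 ▸ hu)
  · exact Or.inr (h2 ▸ hu)

/-- An edge whose two endpoints lie outside `X` is not at `X`. -/
theorem notMem_edgesAt_of_notMem_of_notMem {X : Set V} {e : E} {x y : V}
    (hend : (G.fst e = x ∧ G.snd e = y) ∨ (G.fst e = y ∧ G.snd e = x)) (hx : x ∉ X) (hy : y ∉ X) :
    e ∉ G.edgesAt X := by
  intro he
  rcases hend with ⟨h1, h2⟩ | ⟨h1, h2⟩ <;> rcases he with he | he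
  · exact hx (h1 ▸ he)
  · exact hy (h2 ▸ he)
  · exact hy (h1 ▸ he)
  · exact hx (h2 ▸ he)

/-- **Balls are determined by the edges at the smaller balls**: if `ψ` agrees with `ω` on every edge at
`ball ω a m` for every `m < n`, then `ball ψ a n = ball ω a n`. -/
theorem ball_eq_of_agree {ω ψ : Config E} {a : V} {n : ℕ}
    (h : ∀ m < n, ∀ e ∈ G.edgesAt (G.ball ω a m), ω e = ψ e) : G.ball ψ a n = G.ball ω a n := by
  induction n with
  | zero => rfl
  | succ n ih =>
    have ih' : G.ball ψ a n = G.ball ω a n := ih (fun m hm => h m (Nat.lt_succ_of_lt hm))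
    rw [ball_succ, ball_succ, ih']
    congr 1
    ext v
    simp only [Set.mem_setOf_eq]
    constructor
    · rintro ⟨u, hu, e, he, hend⟩
      refine ⟨u, hu, e, ?_, hend⟩
      rw [h n (Nat.lt_succ_self n) e (mem_edgesAt_of_openAdj_left hu hend)]
      exact he
    · rintro ⟨u, hu, e, he, hend⟩
      refine ⟨u, hu, e, ?_, hend⟩
      rw [← h n (Nat.lt_succ_self n) e (mem_edgesAt_of_openAdj_left hu hend)]
      exact he

/-- **A vertex of a ball disjoint from `X` is reached from `a` by an open walk avoiding `X`.** -/
theorem connAvoid_of_mem_ball {ω : Config E} {a : V} {X : Set V} {n : ℕ}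
    (hX : ∀ u ∈ G.ball ω a n, u ∉ X) {v : V} (hv : v ∈ G.ball ω a n) : G.ConnAvoid ω X a v := by
  induction n generalizing v with
  | zero =>
    rw [ball_zero, Set.mem_singleton_iff] at hv
    rw [hv]
    exact Relation.ReflTransGen.refl
  | succ n ih =>
    have hX' : ∀ u ∈ G.ball ω a n, u ∉ X := fun u hu => hX u (ball_subset_succ ω a n hu)
    rcases hv with hv | ⟨u, hu, huv⟩
    · exact ih hX' hv
    · exact (ih hX' hu).tail ⟨huv, hX' u hu, hX v (Or.inr ⟨u, hu, huv⟩)⟩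

variable (G)

/-- `dist_S(a, X) = r + 1`: the ball of radius `r` around `a` misses `X` and the ball of radius `r + 1`
meets it. -/
def AtDist (ω : Config E) (a : V) (X : Set V) (r : ℕ) : Prop :=
  (∀ u ∈ G.ball ω a r, u ∉ X) ∧ ∃ u ∈ G.ball ω a (r + 1), u ∈ X

variable {G}

/-- The distance is unique. -/
theorem AtDist.unique {ω : Config E} {a : V} {X : Set V} {r r' : ℕ} (h : G.AtDist ω a X r)
    (h' : G.AtDist ω a X r') : r = r' := by
  by_contra hne
  rcases Nat.lt_or_gt_of_ne hne with hlt | hlt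
  · obtain ⟨u, hu, huX⟩ := h.2
    exact h'.1 u (ball_mono ω a (Nat.succ_le_of_lt hlt) hu) huX
  · obtain ⟨u, hu, huX⟩ := h'.2
    exact h.1 u (ball_mono ω a (Nat.succ_le_of_lt hlt) hu) huX

/-- Below the distance, the balls miss `X`. -/
theorem AtDist.not_mem_of_mem_ball {ω : Config E} {a : V} {X : Set V} {r : ℕ}
    (h : G.AtDist ω a X r) {m : ℕ} (hm : m ≤ r) {u : V} (hu : u ∈ G.ball ω a m) : u ∉ X :=
  h.1 u (ball_mono ω a hm hu)

end Ball

end MultiGraph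

end PercRepro
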